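import Summits.BirchSwinnertonDyer.BirchSwinnertonDyer.Theorems.ErratumRoadFiveTwoVariableControl
import Summits.BirchSwinnertonDyer.BirchSwinnertonDyer.Theorems.ErratumRoadFiveIrrKNoFixedTorsionSelfDual
import Summits.BirchSwinnertonDyer.BirchSwinnertonDyer.Theorems.ErratumRoadFiveSelfDualMemberInputs
import Literature.NumberTheory.EllipticCurves.SkinnerUrban2014.CofinitelyGeneratedSelmerProofs
import Literature.NumberTheory.EllipticCurves.IwasawaCyclotomicProofs
import Literature.NumberTheory.EllipticCurves.BDPAnticyclotomicPAdicLFunctionSigmaInt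
import HarnessLib

/-!
# Erratum Thm. 2.3 «⊂» ON THE SELF-DUAL TATE TWIST (F4♯†, crux 23253 `ErratumThm23SigmaLeSelfDual`) ON THE (dec)† LOCUS
# from the two-variable core S1† ALONE (helper, `--supports stmt-BirchSwinnertonDyer-23253`)

Cell `bsd-stepL`, seat `bsd-stepL-imc-p1` (prover g25, 2026-08-28). Theorems only (no definition, no named fact, no
`sorry`, no instance, no notation). RE-INSTANTIATION at the erratum's own module `A_g^† = V_g^†/T_g^†` (the self-dual Tate
twist, `Δ.selfDualCofreeRepOver K`, vocabulary `OrdinaryNewformDatumSelfDualTwist` p657158; TWIST AUDIT memo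
`HOME/imc-p1/g24/TWIST-AUDIT-25505-imc-p1-g24.md`, RULING 76) of imc-p1 g22's
`ErratumRoadFiveErratumThm23DecOfTwoVarCore` (p634294, which serves the UNTWISTED history item 25505).

## What this file proves and why

`erratumThm23SigmaLeSelfDual_dec_of_twoVarCore (hFW : ‹S1† verbatim›) : ‹F4♯† with the extra binder (dec)†›`, where

* S1† = the stub `stub_FW21_twoVarSigmaLePinned_selfDual` of the line `erratum_chain`† for crux 23253 (turnkey
  `HOME/imc-p1/g24/erratum_chain_selfdual-v1-proposed.lean`, by-name edition v2† by g25) VERBATIM — the OPEN two-variable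
  core: [FW21, Thm. 4.41] Σ-imprimitive + App. B Cor. 7.21 ∕ L. 7.22 + the weight-`k` [CGS25, Prop. 2.4.5]-type restriction,
  pinned on `T_c = 0`, for `X^Σ_K(A_g^†) = XBig κ' (AnticyclotomicBigGaloisRep κ (Δ.selfDualCofreeRepOver K)) 𝔭̄ Σ`;
* (dec)† = "`A_g^†` has no non-zero `Γ_{K_𝔭̄}`-fixed `p`-power-torsion element" = erratum Lemma 2.1's own printed hypothesis
  "`H⁰(K_𝔭̄, A_g[ϖ]) = 0`" (p. 2) for the erratum's own `A_g`, placed right after `3 < p`; every other binder and the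
  conclusion are F4♯†'s (`Castella2018.erratumThm23_charIdeal_sigma_le_of_isTorsion_selfDual_OPEN`, p658652) byte for byte.

The proof is p634294's with the module swapped: (glob)† from `IsResiduallyIrreducible Δ`
(`SelfDualTwist.noFixedTorsion_selfDual_of_isResiduallyIrreducible'`, p661970), (unr)†
(`SelfDualTwist.selfDualCofreeRepOver_localMap_inr_apply_eq_self`, p659402: `ε` is unramified away from `p`), the one-variable
finite generation ([SU14 L.3.1.9] in its generic proved form `SkinnerUrban2014.moduleFinite_XBig`, fed with the `Cofree` inputs
`exists_pow_psmul_eq_zero` ∕ `divisible` ∕ `finite_setOf_psmul_eq_zero` at `Δ.selfDualRep`), the two-variable one and the EXACT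
control map (`ControlAt.module_finite_XBig_iterate` ∕ `exists_controlMap` — generic in the representation), a cyclotomic `κ'`
(`exists_cyclotomicZpExtension_holds`), and the descent of [JSW17, Cor. 3.4.2] (`TwoVariableDescent.*`, `CoeffRing.*`).

WHY: K2's deciding theorem `Theses.ErratumRoadFive.closes` (rev 67) applies crux 23253 (binder `h23`) ONLY at the Hida members
`g_m` of `f_E` on the erratum locus, where (iv) `E(ℚ_p)[p] = 0` and the congruence (b†)
`A^†_{g_m}[p^m] ≅ (𝒪_m ⊗ E[p^∞])[p^m]` give (dec)† for `g_m` in the kernel (`SelfDualTwist.forall_fixed_primary_eq_zero_selfDual`,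
p659402). So for K2 the `¬(dec)†` corner of the E-free crux is never entered: along ROAD FF the open input is S1† alone; the full
crux (with the corner) is the sequel `ErratumRoadFiveErratumThm23SelfDualOfTwoVarCoreLocalDefect` (S1† + S2♭♭†).

HONEST FRAMING: CONDITIONAL on its displayed hypothesis S1† (OPEN: unrefereed [FW21] + the unprinted weight-`k` CGS
computation); no summit statement and no crux is proved here; BSD is proved for no pair; closes: none (T7).

[claim: FouquetWan2021, Thm. 4.41, App. B Cor. 7.21, Lemma 7.22, status: under-review]
[claim: Castella2018Erratum, Thm. 2.3, Lemma 2.1, status: under-review]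
[cite: JetchevSkinnerWan2017, §3.4, Lemma 3.4.1, Cor. 3.4.2 (arXiv:1512.06894 p. 14)]
[cite: Castella2018Erratum, §2 (p. 2: "Let `V_g` be the self-dual Tate twist … `A_g := V_g/T_g`")]
-/

noncomputable section

open scoped Classical

open PowerSeries NumberField IsDedekindDomain Field
  Literature.NumberTheory.EllipticCurves Literature.NumberTheory.EllipticCurves.ModularForms
  Literature.NumberTheory.EllipticCurves.BigGaloisRep Literature.NumberTheory.EllipticCurves.GreenbergSelmer
  Literature.NumberTheory.GaloisRepresentations

-- D-0017: single-problem summit, the namespace repeats the problem name by design.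
set_option linter.dupNamespace false
set_option autoImplicit false

namespace Summit.BirchSwinnertonDyer.BirchSwinnertonDyer.Theorems.ErratumThm23TwoVariable.ErratumChainSelfDualDec

set_option maxHeartbeats 800000 in
-- statement-sized packages over the iterated big representation (as `control_newform` ∕ p631770); the proof is glue
/-- **Erratum Thm. 2.3 «⊂» ON THE SELF-DUAL TATE TWIST `A_g^†`, on the (dec)† locus, from the two-variable core S1† alone.**
`hFW` = the stub `stub_FW21_twoVarSigmaLePinned_selfDual` (S1†) of the line `erratum_chain`† of crux 23253 VERBATIM (OPEN:
[FW21 Thm. 4.41] Σ-imprimitive + App. B Cor. 7.21 ∕ L. 7.22 + the weight-`k` CGS restriction, pinned on `T_c = 0`, for the module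
`XBig κ' (AnticyclotomicBigGaloisRep κ (Δ.selfDualCofreeRepOver K)) 𝔭̄ Σ`); conclusion = F4♯†
(`Castella2018.erratumThm23_charIdeal_sigma_le_of_isTorsion_selfDual_OPEN`) with ONE extra binder after `3 < p`: (dec)† "no non-zero
`Γ_{K_𝔭̄}`-fixed `p`-power torsion in `A_g^†`" = erratum Lemma 2.1's "`H⁰(K_𝔭̄, A_g[ϖ]) = 0`" for the erratum's OWN (self-dual) `A_g`.
Everything else — (glob)† from irreducibility (`SelfDualTwist.noFixedTorsion_selfDual_of_isResiduallyIrreducible'`), (unr)†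
(`SelfDualTwist.selfDualCofreeRepOver_localMap_inr_apply_eq_self`), finite generation ([SU14 L.3.1.9] generic form
`SkinnerUrban2014.moduleFinite_XBig` with the `Cofree` inputs), EXACT two-variable control (`ControlAt.*`, generic in the
representation), a cyclotomic `κ'`, the descent [JSW17 Cor. 3.4.2] (`TwoVariableDescent.*`) — is the tree's, instantiated at the twist.
Twin of `ErratumThm23TwoVariable.ErratumChainDec.erratumThm23SigmaLe_dec_of_twoVarCore` (p634294, untwisted module).
[cite: Castella2018Erratum, §2 (p. 2: "the self-dual Tate twist"), Lemma 2.1 (p. 2) and proof of Thm. 2.3: (2.4) ⇒ (2.5) (p. 4)]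
[cite: JetchevSkinnerWan2017, §3.4, Lemma 3.4.1 and Cor. 3.4.2 (arXiv:1512.06894 p. 14)] -/
theorem erratumThm23SigmaLeSelfDual_dec_of_twoVarCore
    (hFW :
      ∀ {p : ℕ} [Fact p.Prime] (ι : PadicAlgCl p ≃+* ℂ) {M : ℕ} [NeZero M] {k : ℤ}
        (g : CuspForm (CongruenceSubgroup.Gamma0 M) k) (ιg : coeffField g →+* PadicAlgCl p)
        (Δ : OrdinaryNewformDatum g p ιg)
        (K : Type) [Field K] [NumberField K] (𝔭 𝔭bar : HeightOneSpectrum (𝓞 K)) (κ : ZpExtension K p)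
        (γ : absoluteGaloisGroup K) [Fact (κ.IsTopGenerator γ)] (S : Finset (HeightOneSpectrum (𝓞 K))),
        IsNewform0 g → 2 ≤ k → Even k → 3 ≤ M → ¬ p ∣ M → 3 < p →
        (∀ x : coeffField g, ι (ιg x) = (x : ℂ)) →
        ‖ιg ⟨(UpperHalfPlane.qExpansion 1 ⇑g).coeff p, coeff_mem_coeffField g p⟩‖ = 1 →
        IsImaginaryQuadratic K → (∃ β : ℤ, (4 * M : ℤ) ∣ β ^ 2 - NumberField.discr K) →
        ((Ideal.span {(p : ℤ)}).primesOver (𝓞 K)).ncard = 2 →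
        ((p : ℕ) : 𝓞 K) ∈ 𝔭.asIdeal →
        (∀ (w : InfinitePlace K) (x : 𝓞 K), x ∈ 𝔭.asIdeal ↔ ‖ι.symm (w.embedding (x : K))‖ < 1) →
        ((p : ℕ) : 𝓞 K) ∈ 𝔭bar.asIdeal → 𝔭bar ≠ 𝔭 →
        SkinnerUrban2014.IsResiduallyIrreducible Δ →
        (∃ v : HeightOneSpectrum (𝓞 ℚ), SkinnerUrban2014.IsResiduallyRamifiedAt Δ v ∧
          ((Rat.HeightOneSpectrum.primesEquiv v : Nat.Primes) : ℕ) ∣ M ∧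
          ¬ ((Rat.HeightOneSpectrum.primesEquiv v : Nat.Primes) : ℕ) ^ 2 ∣ M ∧
          ((Ideal.span {(((Rat.HeightOneSpectrum.primesEquiv v : Nat.Primes) : ℕ) : ℤ)}).primesOver (𝓞 K)).ncard ≠ 2) →
        (((Ideal.span {(2 : ℤ)}).primesOver (𝓞 K)).ncard ≠ 2 → (2 ∣ M ∧ ¬ 4 ∣ M)) →
        (∀ ℓ : ℕ, ℓ.Prime → ℓ ∣ M → ((Ideal.span {(ℓ : ℤ)}).primesOver (𝓞 K)).ncard ≠ 2 →
          ¬ ℓ ^ 2 ∣ M ∧ (UpperHalfPlane.qExpansion 1 ⇑g).coeff ℓ = -((ℓ : ℂ) ^ (k / 2 - 1).toNat)) →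
        κ.IsAnticyclotomic → (∀ w ∈ S, ((p : ℕ) : 𝓞 K) ∉ w.asIdeal) →
        (∀ w : HeightOneSpectrum (𝓞 K), ((M : ℕ) : 𝓞 K) ∈ w.asIdeal → w ∈ S) →
        ∀ (b : padicCoeffIntegers ιg →+* PadicComplexInt p),
          (∀ x, ((b x : PadicComplexInt p) : ℂ_[p]) =
            algebraMap (PadicAlgCl p) ℂ_[p] (padicCoeffIntegers.toPadicAlgCl ιg x)) →
        ∀ (ΩK : ℂ) (Ωp : (PadicComplexInt p)ˣ) (Q : PowerSeries (PadicComplexInt p)), ΩK ≠ 0 →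
          IsBDPLFunctionWtSigmaInt ι 𝔭 κ γ g S ΩK ((Ωp : PadicComplexInt p) : ℂ_[p]) Q →
        -- the complementary (cyclotomic) direction `κ'` with generator `γ'`: `Γ_K = Γ⁺ ⊕ Γ⁻ ≅ ℤ_p²` for `p` odd
        ∀ (κ' : ZpExtension K p) (γ' : absoluteGaloisGroup K) [Fact (κ'.IsTopGenerator γ')], κ'.IsCyclotomic →
        ∀ [TopologicalSpace (PowerSeries (padicCoeffIntegers ιg))]
          [TopologicalSpace (PowerSeries (PowerSeries (padicCoeffIntegers ιg)))]
          [ContinuousSMul (PowerSeries (PowerSeries (padicCoeffIntegers ιg)))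
            (BigRepModule (PowerSeries (padicCoeffIntegers ιg)) p
              (BigRepModule (padicCoeffIntegers ιg) p (Cofree Δ.selfDualRep (padicCoeffField ιg))))],
        -- premise: `X^Σ_K(A_g^†)` is `Λ_K`-torsion; conclusion: a two-variable frame pinned to `Q` on `X = 0` dividing `Ch_{Λ_K}(X^Σ_K(A_g^†))`
        Module.IsTorsion (PowerSeries (PowerSeries (padicCoeffIntegers ιg)))
            (XBig κ' (AnticyclotomicBigGaloisRep κ (Δ.selfDualCofreeRepOver K)) 𝔭bar (↑S)) →
        ∃ Q₂ : PowerSeries (PowerSeries (PadicComplexInt p)),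
          (∃ u : (PowerSeries (PadicComplexInt p))ˣ,
              PowerSeries.constantCoeff Q₂ = (u : PowerSeries (PadicComplexInt p)) * Q) ∧
          (XBig.charIdeal κ' (AnticyclotomicBigGaloisRep κ (Δ.selfDualCofreeRepOver K)) 𝔭bar (↑S)).map
              (PowerSeries.map (PowerSeries.map b)) ≤ Ideal.span {Q₂}) :
    ∀ {p : ℕ} [Fact p.Prime] (ι : PadicAlgCl p ≃+* ℂ) {M : ℕ} [NeZero M] {k : ℤ}
      (g : CuspForm (CongruenceSubgroup.Gamma0 M) k) (ιg : coeffField g →+* PadicAlgCl p)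
      (Δ : OrdinaryNewformDatum g p ιg)
      (K : Type) [Field K] [NumberField K] (𝔭 𝔭bar : HeightOneSpectrum (𝓞 K)) (κ : ZpExtension K p)
      (γ : absoluteGaloisGroup K) [Fact (κ.IsTopGenerator γ)] (S : Finset (HeightOneSpectrum (𝓞 K))),
      IsNewform0 g → 2 ≤ k → Even k → 3 ≤ M → ¬ p ∣ M → 3 < p →
      -- (dec)†: no non-zero `Γ_{K_𝔭̄}`-fixed `p`-power torsion in the SELF-DUAL `A_g^†` (erratum Lemma 2.1: "`H⁰(K_𝔭̄, A_g[ϖ]) = 0`")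
      (∀ a : Cofree Δ.selfDualRep (padicCoeffField ιg),
          (∀ σ : LocalGroup K (Sum.inl 𝔭bar), (Δ.selfDualCofreeRepOver K) (localMap K (Sum.inl 𝔭bar) σ) a = a) →
          (∃ j : ℕ, p ^ j • a = 0) → a = 0) →
      (∀ x : coeffField g, ι (ιg x) = (x : ℂ)) →
      ‖ιg ⟨(UpperHalfPlane.qExpansion 1 ⇑g).coeff p, coeff_mem_coeffField g p⟩‖ = 1 →
      IsImaginaryQuadratic K → (∃ β : ℤ, (4 * M : ℤ) ∣ β ^ 2 - NumberField.discr K) →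
      ((Ideal.span {(p : ℤ)}).primesOver (𝓞 K)).ncard = 2 →
      ((p : ℕ) : 𝓞 K) ∈ 𝔭.asIdeal →
      (∀ (w : InfinitePlace K) (x : 𝓞 K), x ∈ 𝔭.asIdeal ↔ ‖ι.symm (w.embedding (x : K))‖ < 1) →
      ((p : ℕ) : 𝓞 K) ∈ 𝔭bar.asIdeal → 𝔭bar ≠ 𝔭 →
      SkinnerUrban2014.IsResiduallyIrreducible Δ →
      (∃ v : HeightOneSpectrum (𝓞 ℚ), SkinnerUrban2014.IsResiduallyRamifiedAt Δ v ∧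
        ((Rat.HeightOneSpectrum.primesEquiv v : Nat.Primes) : ℕ) ∣ M ∧
        ¬ ((Rat.HeightOneSpectrum.primesEquiv v : Nat.Primes) : ℕ) ^ 2 ∣ M ∧
        ((Ideal.span {(((Rat.HeightOneSpectrum.primesEquiv v : Nat.Primes) : ℕ) : ℤ)}).primesOver (𝓞 K)).ncard ≠ 2) →
      (((Ideal.span {(2 : ℤ)}).primesOver (𝓞 K)).ncard ≠ 2 → (2 ∣ M ∧ ¬ 4 ∣ M)) →
      (∀ ℓ : ℕ, ℓ.Prime → ℓ ∣ M → ((Ideal.span {(ℓ : ℤ)}).primesOver (𝓞 K)).ncard ≠ 2 →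
        ¬ ℓ ^ 2 ∣ M ∧ (UpperHalfPlane.qExpansion 1 ⇑g).coeff ℓ = -((ℓ : ℂ) ^ (k / 2 - 1).toNat)) →
      κ.IsAnticyclotomic → (∀ w ∈ S, ((p : ℕ) : 𝓞 K) ∉ w.asIdeal) →
      (∀ w : HeightOneSpectrum (𝓞 K), ((M : ℕ) : 𝓞 K) ∈ w.asIdeal → w ∈ S) →
      ∀ (b : padicCoeffIntegers ιg →+* PadicComplexInt p),
        (∀ x, ((b x : PadicComplexInt p) : ℂ_[p]) =
          algebraMap (PadicAlgCl p) ℂ_[p] (padicCoeffIntegers.toPadicAlgCl ιg x)) →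
      ∀ (ΩK : ℂ) (Ωp : (PadicComplexInt p)ˣ) (Q : PowerSeries (PadicComplexInt p)), ΩK ≠ 0 →
        IsBDPLFunctionWtSigmaInt ι 𝔭 κ γ g S ΩK ((Ωp : PadicComplexInt p) : ℂ_[p]) Q →
      ∀ [TopologicalSpace (PowerSeries (padicCoeffIntegers ιg))]
        [ContinuousSMul (PowerSeries (padicCoeffIntegers ιg))
          (BigRepModule (padicCoeffIntegers ιg) p (Cofree Δ.selfDualRep (padicCoeffField ιg)))],
      Module.IsTorsion (PowerSeries (padicCoeffIntegers ιg)) (XBig κ (Δ.selfDualCofreeRepOver K) 𝔭bar (↑S)) →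
      (XBig.charIdeal κ (Δ.selfDualCofreeRepOver K) 𝔭bar (↑S)).map (PowerSeries.map b) ≤ Ideal.span {Q} := by
  intro p _ ι M _ k g ιg Δ K _ _ 𝔭 𝔭bar κ γ _ S h1 h2 h3 h4 h5 h6 hdec h7 h8 h9 h10 h11 h12 h13 h14 h15 h16 h17
    h18 h19 h20 h21 h22 b h23 ΩK Ωp Q h24 h25 _i1 _i2 h26
  -- (glob) from irreducibility (tree theorem)
  have hglob := SelfDualTwist.noFixedTorsion_selfDual_of_isResiduallyIrreducible' Δ K h6 h9 h16
  -- a cyclotomic `ℤ_p`-extension with a topological generator; any topology on `Λ_K` (the conclusion does not see it)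
  obtain ⟨κ', hκ'⟩ := Literature.NumberTheory.EllipticCurves.exists_cyclotomicZpExtension_holds K p
  obtain ⟨γ', hγ'⟩ := κ'.surjective (Multiplicative.ofAdd 1)
  haveI : Fact (κ'.IsTopGenerator γ') := ⟨hγ'⟩
  letI : TopologicalSpace (PowerSeries (PowerSeries (padicCoeffIntegers ιg))) := ⊥
  haveI : DiscreteTopology (PowerSeries (PowerSeries (padicCoeffIntegers ιg))) := ⟨rfl⟩
  -- (unr) and the one-variable finite generation, from the tree
  have hSM' : ∀ w : HeightOneSpectrum (𝓞 K), w ∉ (↑S : Set (HeightOneSpectrum (𝓞 K))) →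
      ((M : ℕ) : 𝓞 K) ∉ w.asIdeal := fun w hw hM ↦ hw (Finset.mem_coe.2 (h22 w hM))
  have hunr := SelfDualTwist.selfDualCofreeRepOver_localMap_inr_apply_eq_self Δ K (↑S) hSM'
  haveI := CoeffRing.finiteDimensional_padicCoeffField ιg h1
  haveI : Module.Finite (PowerSeries (padicCoeffIntegers ιg)) (XBig κ (Δ.selfDualCofreeRepOver K) 𝔭bar (↑S)) :=
    SkinnerUrban2014.moduleFinite_XBig κ 𝔭bar (↑S) S.finite_toSet (Δ.selfDualCofreeRepOver K)
      (GreenbergSelmer.Cofree.exists_pow_psmul_eq_zero ιg Δ.selfDualRep)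
      (GreenbergSelmer.Cofree.divisible (padicCoeffField ιg) Δ.selfDualRep (Fact.out : p.Prime).ne_zero)
      (GreenbergSelmer.Cofree.finite_setOf_psmul_eq_zero ιg Δ.selfDualRep) hunr
  haveI := ControlAt.module_finite_XBig_iterate κ κ' (Δ.selfDualCofreeRepOver K) 𝔭bar (↑S) hglob hdec hunr
  -- the EXACT control map (kernel zero, hence pseudo-null), packaged with `Exists.choose`
  have key := ControlAt.exists_controlMap κ κ' (Δ.selfDualCofreeRepOver K) 𝔭bar (↑S) hglob hdec hunr
  -- ring-theoretic clauses for the newform's coefficient ring (as in `AtData…`, p611089 §1)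
  haveI : IsPrincipalIdealRing (padicCoeffIntegers ιg) := CoeffRing.isPrincipalIdealRing ιg
  haveI : UniqueFactorizationMonoid (PowerSeries (PowerSeries (padicCoeffIntegers ιg))) :=
    CoeffRing.uniqueFactorizationMonoid_powerSeries_powerSeries ιg
  -- two-variable torsion from the one-variable torsion premise + control (determinant trick)
  have hs := TwoVariableDescent.exists_constantCoeff_ne_zero_of_control
    (A := PowerSeries (padicCoeffIntegers ιg))
    (XBig κ' (AnticyclotomicBigGaloisRep κ (Δ.selfDualCofreeRepOver K)) 𝔭bar (↑S))
    (XBig κ (Δ.selfDualCofreeRepOver K) 𝔭bar (↑S)) h26 key.choose key.choose_spec.2.2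
  have htors₂ := TwoVariableDescent.isTorsion_of_exists_constantCoeff_ne_zero
    (A := PowerSeries (padicCoeffIntegers ιg))
    (XBig κ' (AnticyclotomicBigGaloisRep κ (Δ.selfDualCofreeRepOver K)) 𝔭bar (↑S)) hs
  -- the two-variable core (S1), for this cyclotomic `κ'`
  obtain ⟨Q₂, ⟨u, hu⟩, hle⟩ := hFW ι g ιg Δ K 𝔭 𝔭bar κ γ S h1 h2 h3 h4 h5 h6 h7 h8 h9 h10 h11 h12 h13
    h14 h15 h16 h17 h18 h19 h20 h21 h22 b h23 ΩK Ωp Q h24 h25 κ' γ' hκ' htors₂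
  -- descent of the characteristic ideal along `T_c ↦ 0` (JSW Cor. 3.4.2, kernel form), read in `𝓞_{ℂ_p}`
  have hdesc := TwoVariableDescent.charIdeal_le_map_constantCoeff_of_control
    (A := PowerSeries (padicCoeffIntegers ιg))
    (XBig κ' (AnticyclotomicBigGaloisRep κ (Δ.selfDualCofreeRepOver K)) 𝔭bar (↑S))
    (XBig κ (Δ.selfDualCofreeRepOver K) 𝔭bar (↑S)) h26 key.choose key.choose_spec.1 key.choose_spec.2.2
  refine (Ideal.map_mono hdesc).trans ?_
  rw [TwoVariableDescent.map_map_constantCoeff_eq b]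
  exact TwoVariableDescent.map_constantCoeff_le_span_of_le_span_of_eq_unit_mul hle hu

end Summit.BirchSwinnertonDyer.BirchSwinnertonDyer.Theorems.ErratumThm23TwoVariable.ErratumChainSelfDualDec

end
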